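import Literature.NumberTheory.EllipticCurves.IsogenyFormulaOfPlaceCompSelf
import Literature.NumberTheory.EllipticCurves.CMSqrtEndomorphism
import Literature.NumberTheory.EllipticCurves.QuadraticOrderPlace
import Literature.NumberTheory.EllipticCurves.DeuringSplitOrdinaryProofs
import Literature.NumberTheory.EllipticCurves.IsogenyFormulaCertKronecker
import HarnessLib

/-!
# Deuring's theorem for the certified CM curves: ordinary reduction at split primes

Topic `NumberTheory/EllipticCurves` (trunk T-ELLARITH, notion `cm_endomorphisms_isogeny`).
This file assembles, for a CM elliptic curve `E = [0, 0, 0, A, B]` over `ℤ` presented by a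
kernel-certified isogeny `φ : E → E^{(d)}` onto its quadratic twist (the tree's `IsogenyCert`s
of `CMIsogenyCertificates`: `d = -7, -11, -19, -43, -67, -163`), the proof that **the reduction
of `E` at an odd prime `p ∤ d Δ(E)` at which `d` is a square has a point of order `p`**
(`exists_ne_zero_nsmul_eq_zero_of_isogenyCert`) — the first assertion of Lang, *Elliptic
Functions*, Ch. 13 §4 Thm. 12 in the split case (Deuring 1941), for these curves:

1. `[√d] = τ ∘ φ` is the isogeny of the twisted formula `(U, √d·h, S, 0)` (`CMSqrtEndomorphism`)
   over `ℚ(√d)` (`QuadraticOrderPlace.sqrtField`), and `[√d]² = [d]` on `E(ℚ̄)` by Cor. III.6.3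
   of *AEC* and conjugation (`IsogenyFormula.sqrtEndo_comp_self`);
2. at a place of `ℚ̄` above `p` (`SplitPlace`) the twisted formula over `ℤ[√d]` reduces to an
   isogeny `ψ̄` of `E ⊗ 𝔽_p` over `𝔽_p` (`IsogenyFormula.toIsogenyOfPlace`, *AEC* III.4.8 by
   lifting) with `ψ̄² = [d]` (`IsogenyFormula.toIsogenyOfPlace_comp_self`, *AT* II.4.4);
3. an isogeny `ψ̄` with `ψ̄² = [d]`, `(d/p) = 1`, forces a point of order `p`
   (`Isogeny.exists_ne_zero_nsmul_eq_zero_of_comp_self_eq_smul`, `DeuringSplitOrdinaryProofs`).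

## References

* [Lang1987] S. Lang, *Elliptic Functions*, 2nd ed., Ch. 13 §4 Thm. 12 (PDF pp. 140–141).
* [Deuring1941] M. Deuring, Abh. Math. Sem. Univ. Hamburg 14 (1941).
* [SilvermanAEC2009] *AEC*, Thm. III.4.8, Cor. III.6.3, Prop. VII.2.1;
  [SilvermanAdvancedTopics1994] *AT*, II §2, Prop. II.4.4, App. A §3.

## Design

Definitions with bodies (the models `curve`, `curve'`, `curveO`, `curveF`, the formulas `φO`,
`Φ`, `φF`, the isogenies `sqrtEndoF`, `sqrtEndoModP`, and the `Prop`-valued *structure*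
`IsCMTwistCert` of numeric side conditions — a conjunction of decidable equalities about the
certificate, not a named fact) and theorems. The final statement is generic in the certificate
`c` and carries the numeric side conditions (short models, twist relation, monic `U, h`,
`deg U = -d`, `p ∤ Δ`) as hypotheses, discharged by `decide` for each certificate by the
consumer `DeuringSplitOrdinaryModelsProofs` (which also feeds two tiny certificates for
`d = -3, -4`).
-/

noncomputable section

open scoped Classical

open Polynomial IsLocalRing Literature.NumberTheory.EllipticCurves
  Literature.NumberTheory.EllipticCurves.PolyCert

namespace Literature.NumberTheory.EllipticCurves

namespace DeuringCert

/-- The integral short model `E = [a₁, a₂, a₃, a₄, a₆]` recorded in a certificate. [folklore] -/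
def curve (c : IsogenyCert) : WeierstrassCurve ℤ := ⟨c.a₁, c.a₂, c.a₃, c.a₄, c.a₆⟩

/-- The twist `E' = [a₁', …, a₆']` recorded in a certificate. [folklore] -/
def curve' (c : IsogenyCert) : WeierstrassCurve ℤ := ⟨c.a₁', c.a₂', c.a₃', c.a₄', c.a₆'⟩

/-- **Numeric side conditions on a certificate** for the CM construction: short models, `E'` is
the quadratic twist `E^{(d)}`, `T = 0`, monic `U` and `h`, `deg U = -d`. [folklore] -/
structure IsCMTwistCert (c : IsogenyCert) (d : ℤ) : Prop where
  /-- `a₁ = 0`. -/ a₁ : c.a₁ = 0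
  /-- `a₂ = 0`. -/ a₂ : c.a₂ = 0
  /-- `a₃ = 0`. -/ a₃ : c.a₃ = 0
  /-- `a₁' = 0`. -/ a₁' : c.a₁' = 0
  /-- `a₂' = 0`. -/ a₂' : c.a₂' = 0
  /-- `a₃' = 0`. -/ a₃' : c.a₃' = 0
  /-- `a₄' = d² a₄`. -/ a₄' : c.a₄' = d ^ 2 * c.a₄
  /-- `a₆' = d³ a₆`. -/ a₆' : c.a₆' = d ^ 3 * c.a₆
  /-- `T = 0`. -/ T : c.T = []
  /-- `U` is monic. -/ U_top : coeffL c.U (c.U.length - 1) = 1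
  /-- `h` is monic. -/ h_top : coeffL c.h (c.h.length - 1) = 1
  /-- `deg U = -d`. -/ deg : ((c.U.length - 1 : ℕ) : ℤ) = -d

variable {c : IsogenyCert} {d : ℤ}

section Order

variable [Fact (d < 0)] (hc : c.check = true) (H : IsCMTwistCert c d)

/-- The model over `ℤ[√d]`. [folklore] -/
abbrev curveO (c : IsogenyCert) (d : ℤ) : WeierstrassCurve (ℤ√d) :=
  (curve c).map (Int.castRingHom _)

/-- The twist over `ℤ[√d]`. [folklore] -/
abbrev curveO' (c : IsogenyCert) (d : ℤ) : WeierstrassCurve (ℤ√d) :=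
  (curve' c).map (Int.castRingHom _)

/-- The certified formula `E → E'` over `ℤ[√d]`. [folklore] -/
def φO : WeierstrassCurve.IsogenyFormula (curveO c d) (curveO' c d) :=
  c.toFormula hc (curveO c d) (curveO' c d) rfl rfl

omit [Fact (d < 0)] in
include H in
/-- The twisting data over `ℤ[√d]`. [folklore] -/
theorem isTwistBy_φO : (φO (d := d) hc).IsTwistBy (d : ℤ√d) where
  a₁ := by change ((c.a₁ : ℤ) : ℤ√d) = 0; rw [H.a₁, Int.cast_zero]
  a₂ := by change ((c.a₂ : ℤ) : ℤ√d) = 0; rw [H.a₂, Int.cast_zero]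
  a₃ := by change ((c.a₃ : ℤ) : ℤ√d) = 0; rw [H.a₃, Int.cast_zero]
  a₁' := by change ((c.a₁' : ℤ) : ℤ√d) = 0; rw [H.a₁', Int.cast_zero]
  a₂' := by change ((c.a₂' : ℤ) : ℤ√d) = 0; rw [H.a₂', Int.cast_zero]
  a₃' := by change ((c.a₃' : ℤ) : ℤ√d) = 0; rw [H.a₃', Int.cast_zero]
  a₄' := by change ((c.a₄' : ℤ) : ℤ√d) = _ * ((c.a₄ : ℤ) : ℤ√d); rw [H.a₄']; push_cast; ring
  a₆' := by change ((c.a₆' : ℤ) : ℤ√d) = _ * ((c.a₆ : ℤ) : ℤ√d); rw [H.a₆']; push_cast; ring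
  T := by change (ofList c.T : (ℤ√d)[X]) = 0; rw [H.T]; rfl

/-- `√d ≠ 0` in `ℤ√d`. [folklore] -/
theorem sqrtd_ne_zero : (Zsqrtd.sqrtd : ℤ√d) ≠ 0 := fun h ↦ by
  have h2 := Zsqrtd.sqrtd_sq d
  rw [h, zero_pow two_ne_zero] at h2
  have : (d : ℤ√d) = 0 := h2.symm
  exact (Fact.out : d < 0).ne (by exact_mod_cast this)

/-- `C √d` is cancellable in `ℤ√d[X]` (`ℤ√d` is a domain for `d < 0`). [folklore] -/
theorem C_sqrtd_mul_cancel (q : (ℤ√d)[X]) (h : C (Zsqrtd.sqrtd : ℤ√d) * q = 0) : q = 0 := by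
  haveI := Zsqrtd.isDomain_of_neg (d := d) Fact.out
  exact (mul_eq_zero.mp h).resolve_left (C_ne_zero.mpr sqrtd_ne_zero)

/-- **The twisted formula `[√d] : E → E` over `ℤ[√d]`.** [folklore] -/
def Φ : WeierstrassCurve.IsogenyFormula (curveO c d) (curveO c d) :=
  (φO hc).twist (isTwistBy_φO hc H) Zsqrtd.sqrtd (Zsqrtd.sqrtd_sq d) C_sqrtd_mul_cancel

include H in
/-- `U` is monic over `ℤ[√d]`. [folklore] -/
theorem monic_Φ_U : (Φ hc H).U.Monic := by
  change (ofList c.U : (ℤ√d)[X]).Monic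
  exact IsogenyCert.monic_ofList _ H.U_top

include H in
/-- The leading coefficient of `√d · h` is `√d`. [folklore] -/
theorem leadingCoeff_Φ_h : (Φ hc H).h.leadingCoeff = Zsqrtd.sqrtd := by
  haveI := Zsqrtd.isDomain_of_neg (d := d) Fact.out
  change (C (Zsqrtd.sqrtd : ℤ√d) * (ofList c.h : (ℤ√d)[X])).leadingCoeff = _
  rw [leadingCoeff_mul, leadingCoeff_C, (IsogenyCert.monic_ofList _ H.h_top).leadingCoeff, mul_one]

end Order

/-! ## The side of characteristic `0`: `[√d]² = [d]` on `E(\overline{ℚ(√d)})` -/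

section CharZero

variable [Fact (d < 0)] (hc : c.check = true) (H : IsCMTwistCert c d)

/-- The model over `ℚ(√d)`. [folklore] -/
abbrev curveF (c : IsogenyCert) (d : ℤ) [Fact (d < 0)] : WeierstrassCurve (sqrtField d) :=
  (curveO c d).map (sqrtField.ofInt d)

include H in
/-- The formula over `ℚ(√d)` (leading coefficients `1` survive). [folklore] -/
theorem ofOrder_leadingCoeff_U_ne_zero : sqrtField.ofInt d (φO (d := d) hc).U.leadingCoeff ≠ 0 := by
  change sqrtField.ofInt d (ofList c.U : (ℤ√d)[X]).leadingCoeff ≠ 0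
  rw [(IsogenyCert.monic_ofList _ H.U_top).leadingCoeff, map_one]; exact one_ne_zero

include H in
/-- The formula over `ℚ(√d)` (leading coefficients `1` survive). [folklore] -/
theorem ofOrder_leadingCoeff_h_ne_zero : sqrtField.ofInt d (φO (d := d) hc).h.leadingCoeff ≠ 0 := by
  change sqrtField.ofInt d (ofList c.h : (ℤ√d)[X]).leadingCoeff ≠ 0
  rw [(IsogenyCert.monic_ofList _ H.h_top).leadingCoeff, map_one]; exact one_ne_zero

/-- The certified formula read over `ℚ(√d)`. [folklore] -/
def φF : WeierstrassCurve.IsogenyFormula (curveF c d) ((curveO' c d).map (sqrtField.ofInt d)) :=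
  (φO hc).mapOfLeadingCoeff (sqrtField.ofInt d) (ofOrder_leadingCoeff_U_ne_zero hc H)
    (ofOrder_leadingCoeff_h_ne_zero hc H)

/-- The twisting data over `ℚ(√d)`. [folklore] -/
theorem isTwistBy_φF : (φF hc H).IsTwistBy (d : sqrtField d) := by
  have H0 := isTwistBy_φO hc H
  refine ⟨?_, ?_, ?_, ?_, ?_, ?_, ?_, ?_, ?_⟩
  · change sqrtField.ofInt d (curveO c d).a₁ = 0; rw [H0.a₁, map_zero]
  · change sqrtField.ofInt d (curveO c d).a₂ = 0; rw [H0.a₂, map_zero]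
  · change sqrtField.ofInt d (curveO c d).a₃ = 0; rw [H0.a₃, map_zero]
  · change sqrtField.ofInt d (curveO' c d).a₁ = 0; rw [H0.a₁', map_zero]
  · change sqrtField.ofInt d (curveO' c d).a₂ = 0; rw [H0.a₂', map_zero]
  · change sqrtField.ofInt d (curveO' c d).a₃ = 0; rw [H0.a₃', map_zero]
  · change sqrtField.ofInt d (curveO' c d).a₄ = _ * sqrtField.ofInt d (curveO c d).a₄
    rw [H0.a₄', map_mul, map_pow, map_intCast (sqrtField.ofInt d) d]
  · change sqrtField.ofInt d (curveO' c d).a₆ = _ * sqrtField.ofInt d (curveO c d).a₆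
    rw [H0.a₆', map_mul, map_pow, map_intCast (sqrtField.ofInt d) d]
  · change (φO hc).T.map _ = 0; rw [H0.T, Polynomial.map_zero]

/-- The data of `φF` are the certificate lists read over `ℚ(√d)`. [folklore] -/
theorem φF_U : (φF hc H).U = ofList c.U := by
  change (ofList c.U : (ℤ√d)[X]).map _ = _; exact IsogenyCert.map_ofList _ _
/-- The data of `φF` are the certificate lists read over `ℚ(√d)`. [folklore] -/
theorem φF_h : (φF hc H).h = ofList c.h := by
  change (ofList c.h : (ℤ√d)[X]).map _ = _; exact IsogenyCert.map_ofList _ _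
/-- The data of `φF` are the certificate lists read over `ℚ(√d)`. [folklore] -/
theorem φF_S : (φF hc H).S = ofList c.S := by
  change (ofList c.S : (ℤ√d)[X]).map _ = _; exact IsogenyCert.map_ofList _ _

/-- The integral model read over `ℚ(√d)` is an elliptic curve when `Δ ≠ 0`. [folklore] -/
theorem isElliptic_curveF (c : IsogenyCert) (d : ℤ) [Fact (d < 0)] (hΔ : (curve c).Δ ≠ 0) :
    (curveF c d).IsElliptic := by
  refine ⟨?_⟩
  rw [WeierstrassCurve.map_Δ, WeierstrassCurve.map_Δ, isUnit_iff_ne_zero,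
    eq_intCast (Int.castRingHom (ℤ√d)), map_intCast (sqrtField.ofInt d)]
  exact Int.cast_ne_zero.mpr hΔ

/-- **The endomorphism `[√d]` of `E` over `ℚ(√d)`.** [folklore] -/
def sqrtEndoF [(curveF c d).IsElliptic] : WeierstrassCurve.Isogeny (curveF c d) (curveF c d) :=
  (φF hc H).sqrtEndo (isTwistBy_φF hc H) (sqrtField.r d) (sqrtField.r_sq' d) (sqrtField.r_ne_zero d)

/-- `σ̄` fixes the coefficients of `E` (they are integers). [folklore] -/
theorem map_conjBar_curveF :
    ((curveF c d).baseChange (AlgebraicClosure (sqrtField d))).map (sqrtField.conjBar d).toRingHom = (curveF c d).baseChange (AlgebraicClosure (sqrtField d)) := by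
  simp only [WeierstrassCurve.baseChange, WeierstrassCurve.map_map]
  congr 1
  exact Subsingleton.elim _ _

/-- Integer-coefficient lists read over `F̄` are fixed by `σ̄`. [folklore] -/
theorem map_conjBar_ofList (l : List ℤ) :
    ((ofList l : (sqrtField d)[X]).map (algebraMap (sqrtField d) (AlgebraicClosure (sqrtField d)))).map (sqrtField.conjBar d).toRingHom =
      (ofList l : (sqrtField d)[X]).map (algebraMap (sqrtField d) (AlgebraicClosure (sqrtField d))) := by
  rw [IsogenyCert.map_ofList, IsogenyCert.map_ofList]

variable (cop : CoprimeCert) {k' : ℕ} (hcop : c.checkCoprime cop k' = true) (hℓ : cop.ℓ.Prime)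

include hcop hℓ H in
/-- **`[√d] ∘ [√d] = [d]` on `E(\overline{ℚ(√d)})`** (`IsogenyFormula.sqrtEndo_comp_self` with the
conjugation `σ̄` and `deg U = -d`). [cite: SilvermanAEC2009, Cor. III.6.3] -/
theorem sqrtEndoF_comp_self [(curveF c d).IsElliptic] (Q : (curveF c d).geomPoints) :
    sqrtEndoF hc H (sqrtEndoF hc H Q) = d • Q := by
  have hcopF : IsCoprime ((φF hc H).U.map (algebraMap (sqrtField d) (AlgebraicClosure (sqrtField d)))) ((φF hc H).h.map (algebraMap (sqrtField d) (AlgebraicClosure (sqrtField d)))) := by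
    rw [φF_U, φF_h, IsogenyCert.map_ofList, IsogenyCert.map_ofList]
    exact IsogenyCert.isCoprime_of_checkCoprime hcop hℓ _
  have h := (φF hc H).sqrtEndo_comp_self (isTwistBy_φF hc H) (sqrtField.r d) (sqrtField.r_sq' d)
    (sqrtField.r_ne_zero d) (sqrtField.conjBar d) (sqrtField.conjBar_r d) map_conjBar_curveF
    (by rw [φF_U]; exact map_conjBar_ofList _) (by rw [φF_h]; exact map_conjBar_ofList _)
    (by rw [φF_S]; exact map_conjBar_ofList _) hcopF Q
  have hdeg : ((φF hc H).U.natDegree : ℤ) = -d := by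
    rw [φF_U, IsogenyCert.natDegree_ofList_eq c.U (by rw [H.U_top]; exact one_ne_zero)]
    exact H.deg
  rw [sqrtEndoF, h, hdeg, neg_smul, neg_neg]

end CharZero

/-! ## Reduction: a point of order `p` on `E ⊗ 𝔽_p` -/

section Reduction

variable [Fact (d < 0)] {p : ℕ} [Fact p.Prime] (hc : c.check = true) (H : IsCMTwistCert c d)
  (cop : CoprimeCert) {k' : ℕ} (hcop : c.checkCoprime cop k' = true) (hℓ : cop.ℓ.Prime)
  (hp2 : p ≠ 2) (hpd : ¬ (p : ℤ) ∣ d) (hsq : IsSquare ((d : ℤ) : ZMod p))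
  (hΔ : ¬ (p : ℤ) ∣ (curve c).Δ) (P : SplitPlace d p)

include hΔ in
/-- Good reduction over `𝔽_p`. [folklore] -/
theorem isElliptic_map_f₀ : ((curveO c d).map P.f₀).IsElliptic := by
  refine ⟨?_⟩
  rw [WeierstrassCurve.map_Δ, WeierstrassCurve.map_Δ, isUnit_iff_ne_zero,
    eq_intCast (Int.castRingHom (ℤ√d)), map_intCast P.f₀, Ne, ZMod.intCast_zmod_eq_zero_iff_dvd]
  exact hΔ

include hΔ in
/-- Good reduction over the valuation ring of the place. [folklore] -/
theorem isElliptic_map_fA : ((curveO c d).map P.fA).IsElliptic := by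
  haveI := P.charP
  refine ⟨?_⟩
  rw [WeierstrassCurve.map_Δ, WeierstrassCurve.map_Δ, eq_intCast (Int.castRingHom (ℤ√d)),
    map_intCast P.fA]
  apply isUnit_of_residue_ne_zero
  rw [map_intCast (residue P.A), Ne, CharP.intCast_eq_zero_iff (ResidueField P.A) p]
  exact hΔ

omit [Fact (d < 0)] [Fact p.Prime] in
include hΔ in
/-- `Δ ≠ 0` over `ℤ`. [folklore] -/
theorem Δ_ne_zero : (curve c).Δ ≠ 0 := fun h ↦ hΔ (by rw [h]; exact dvd_zero _)

/-- **The reduction `ψ̄` of `[√d]` modulo the place**: an isogeny of `E ⊗ 𝔽_p` over `𝔽_p`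
(`IsogenyFormula.toIsogenyOfPlace`). [folklore] -/
def sqrtEndoModP : WeierstrassCurve.Isogeny ((curveO c d).map P.f₀) ((curveO c d).map P.f₀) :=
  haveI := isElliptic_map_f₀ hΔ P
  haveI := isElliptic_map_fA hΔ P
  (Φ hc H).toIsogenyOfPlace p P.f₀
    (by rw [(monic_Φ_U hc H).leadingCoeff, map_one]; exact one_ne_zero)
    (by rw [leadingCoeff_Φ_h hc H, P.f₀_sqrtd]; exact P.s₀_ne_zero hpd)
    P.A P.fA (by rw [(monic_Φ_U hc H).leadingCoeff, map_one]; exact isUnit_one)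
    (by rw [leadingCoeff_Φ_h hc H, P.fA_sqrtd]; exact P.isUnit_uA hpd) P.g P.g_comp_f₀

include hcop hℓ in
/-- **`ψ̄ ∘ ψ̄ = [d]` on `E(\overline{𝔽_p})`** (reduction of `[√d]² = [d]`,
`IsogenyFormula.toIsogenyOfPlace_comp_self`). [cite: SilvermanAdvancedTopics1994, Prop. II.4.4] -/
theorem sqrtEndoModP_comp_self (X : ((curveO c d).map P.f₀).geomPoints) :
    sqrtEndoModP hc H hpd hΔ P (sqrtEndoModP hc H hpd hΔ P X) = d • X := by
  haveI := isElliptic_map_f₀ hΔ P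
  haveI := isElliptic_map_fA hΔ P
  haveI : (curveF c d).IsElliptic := isElliptic_curveF c d (Δ_ne_zero hΔ)
  have hC := @WeierstrassCurve.IsogenyFormula.C_mul_cancel (sqrtField d) _ _ (sqrtField.r_ne_zero d)
  set ΦF := (φF hc H).twist (isTwistBy_φF hc H) (sqrtField.r d) (sqrtField.r_sq' d) hC with hΦF
  refine (Φ hc H).toIsogenyOfPlace_comp_self p P.f₀ _ _ (sqrtField.ofInt d) ΦF rfl ?_ rfl ?_
    P.A P.fA P.algebraMap_comp_fA _ _ P.g P.g_comp_f₀ (sqrtEndoF hc H) ?_ d ?_ X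
  · -- `h`: `C r * (h.map) = (C ω * h).map`
    change C (sqrtField.r d) * ((φO hc).h.map (sqrtField.ofInt d)) =
      (C (Zsqrtd.sqrtd : ℤ√d) * (φO hc).h).map (sqrtField.ofInt d)
    rw [Polynomial.map_mul, map_C, sqrtField.ofInt_sqrtd]
  · change (0 : (sqrtField d)[X]) = (0 : (ℤ√d)[X]).map (sqrtField.ofInt d)
    rw [Polynomial.map_zero]
  · intro Q hQ
    exact ΦF.geomHom_apply_of_not_mem hQ
  · exact sqrtEndoF_comp_self hc H cop hcop hℓ

include hc H hcop hℓ hp2 hpd hsq hΔ in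
/-- **Deuring's theorem for a certified CM curve, split case**: the reduction modulo an odd prime
`p ∤ d Δ(E)` with `(d/p) = 1` of the CM curve `E = [0, 0, 0, A, B]` of the certificate has a point
of order `p` over `\overline{𝔽_p}` (it is ordinary). Lang, *Elliptic Functions*, Ch. 13 §4
Thm. 12 (first assertion, split case); Deuring 1941.
[cite: Lang1987, Ch. 13 §4 Thm. 12 (PDF pp. 140–141)] [cite: Deuring1941] -/
theorem exists_ne_zero_nsmul_eq_zero_of_isogenyCert :
    ∃ X : ((curve c).map (Int.castRingHom (ZMod p))).geomPoints, X ≠ 0 ∧ p • X = 0 := by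
  obtain ⟨P⟩ := exists_splitPlace d p hsq
  haveI := isElliptic_map_f₀ (c := c) hΔ P
  obtain ⟨X, hX0, hXp⟩ :=
    WeierstrassCurve.Isogeny.exists_ne_zero_nsmul_eq_zero_of_comp_self_eq_smul p hp2
      (sqrtEndoModP hc H hpd hΔ P) (sqrtEndoModP_comp_self hc H cop hcop hℓ hpd hΔ P)
      (Fact.out : d < 0) hpd hsq
  -- transport along `(E ⊗ ℤ[√d]) ⊗_{f₀} 𝔽_p = E ⊗ 𝔽_p`
  have hcurve : (((curveO c d).map P.f₀).baseChange (AlgebraicClosure (ZMod p))).map (RingHom.id _) =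
      ((curve c).map (Int.castRingHom (ZMod p))).baseChange (AlgebraicClosure (ZMod p)) := by
    simp only [WeierstrassCurve.map_id, WeierstrassCurve.baseChange, WeierstrassCurve.map_map]
    congr 1
    exact Subsingleton.elim _ _
  refine ⟨WeierstrassCurve.mapPoint (RingHom.id _) hcurve X, fun h ↦ hX0 ?_, ?_⟩
  · exact WeierstrassCurve.mapPoint_injective _ hcurve
      (h.trans (WeierstrassCurve.mapPoint (RingHom.id _) hcurve).map_zero.symm)
  · have h1 := congrArg (WeierstrassCurve.mapPoint (RingHom.id _) hcurve) hXp
    exact ((WeierstrassCurve.mapPoint (RingHom.id _) hcurve).map_nsmul p X).symm.trans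
      (h1.trans (WeierstrassCurve.mapPoint (RingHom.id _) hcurve).map_zero)

end Reduction

end DeuringCert

end Literature.NumberTheory.EllipticCurves
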